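import Mathlib
import Literature.NumberTheory.LFunctions.Zhang2022.Section12XiSharpToSmooth
import Literature.NumberTheory.LFunctions.Zhang2022.Section12U024RelHolds
import Literature.NumberTheory.LFunctions.Zhang2022.TypedSection12BRel
import HarnessLib

/-!
# Zhang (2022) §12, proof of Lemma 12.3: `Z22:§12.u030` in the relative reading — the assembly
# `U030Rel ⇐ (sharp → g-smoothed, Q-34) + (g-smoothed sum = L′(1,χ)Π(d,r)·circle value)`

Topic `Literature/NumberTheory/LFunctions/Zhang2022` (Landau–Siegel audit tree; verdict-neutral).
Y. Zhang, *Discrete mean estimates and the Landau–Siegel zero*, arXiv:2211.02515v1 (2022)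
[Zhang2022LandauSiegel] — **an unrefereed manuscript under adjudication; theorem-only file, nothing here
bears on its Theorems 1–2 or on Landau–Siegel zeros** (lane ZHANG-L, WP12, node C-U030 =
`Typed.Sec12B.U030Rel`, route (i) of record W12-R3/S-8c; second hand zl-w10-p4 next to zl-libB-p8).

"By (4) and (4) and Lemma 8.3, for `P″₁ < dr < P₂`, `|w| = α`,
`Σ_{l<P″₂/dr} χ(l)ξ_j(l;d,r)/l^{1−β₆+w} = L′(1,χ)Π(d,r)·(2πi)⁻¹∫_{|s|=5α}(…)(P″₂/dr)^s ds/s + O(𝓛⁻¹⁵)`"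
(p. 70, proof of Lemma 12.3, first display) — in the RELATIVE currency `C𝓛⁻¹⁵·Π̂(dr)²`
(`Π̂(n) = ∏_{q∣n}(1−q⁻¹)⁻¹`; `Typed.Sec12B.U030Rel`, TypedSection12BRel). This file is the top of the
route-(i) chain: it threads the two inputs

* (E3) sharp → `g_{𝓛³⁰}`-smoothed sum, `XiZeroMajorant.xi_sharp_sub_smooth_le` (Q-34, error
  `C·(r/φ(r))·𝓛⁻¹⁵`, range `T ≤ Z ≤ P″₂`, `|w| ≤ α`), applied at `Z = P″₂/(dr)`;
* (APP) the evaluation of the smoothed sum by the shifted Lemma-8.4 contour at `Λ = 𝓛³⁰`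
  (`= L′(1,χ)Π(d,r)·circ030 + O(𝓛⁻¹⁵·Π̂(dr)²)`), taken here as the hypothesis `hApp` in the exact shape the
  contour application delivers (zl-libB-p8's `Section12U030ContourApp`),

through the range facts `T ≤ P″₂/(dr) ≤ P″₂` on `P″₁ < dr < P₂` (`P″₂/P₂ = D·t₀·T¹⁰ ≥ T`) and the weight
comparison `r/φ(r) ≤ Π̂(dr) ≤ Π̂(dr)²` (`self_div_totient_le_prod`, `prod_le_prod_sq`).

* `bigT_le_P2pp_div` , `P2pp_div_le_of_one_le` — the range facts; `tsum_term_mul_eq` — Perron/Q-34 summand match;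
* `u030Rel_of_smoothedEval` / `u030Rel_of_smoothedEvalClosed` — `U030Rel c′` from (APP) (Q-34 discharged inside);
* `circ030_eq_closedForm` — u031 with the primitive evaluated (the package main-term shape).

## References

* Y. Zhang, arXiv:2211.02515v1 (2022), §12 proof of Lemma 12.3 p. 70, tex L3552; §4 (4.2)–(4.3); §8 Lemma 8.3.
  [cite: Zhang2022LandauSiegel, §12 proof of Lemma 12.3, p. 70]
-/

noncomputable section

open Complex Real

namespace Literature.NumberTheory.LFunctions.Zhang2022.Typed.Sec12B

open Literature.NumberTheory.LFunctions.Zhang2022.Skeleton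

/-! ## Range facts for `Z = P″₂/(dr)` on the top range `P″₁ < dr < P₂` -/

/-- `P″₂/P₂ = D·t₀·T¹⁰` (`P″₂ = P^{1/2}·D·t₀`, `P₂ = P^{1/2}T⁻¹⁰`). [cite: Zhang2022LandauSiegel, §12 p. 70; §2 (2.21)] -/
theorem P2pp_div_P2_eq (D : ℕ) : P2pp D / Skeleton.P2 D = (D : ℝ) * t0 D * bigT D ^ 10 := by
  have hP : 0 < bigP D ^ (0.5 : ℝ) := Real.rpow_pos_of_pos (by rw [bigP]; exact Real.exp_pos _) _
  have hT : 0 < bigT D ^ 10 := pow_pos (by rw [bigT]; exact Real.exp_pos _) _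
  rw [P2pp, Skeleton.P2]
  field_simp

/-- On the top range: for `0 < x < P₂` and `𝓛 ≥ 3`, `T ≤ P″₂/x` (since `P″₂/P₂ = D·t₀·T¹⁰ ≥ T`).
[cite: Zhang2022LandauSiegel, §12 proof of Lemma 12.3, p. 70] -/
theorem bigT_le_P2pp_div {D : ℕ} (hL : 3 ≤ ell D) {x : ℝ} (hx0 : 0 < x) (hx : x < Skeleton.P2 D) :
    bigT D ≤ P2pp D / x := by
  have hℓ0 : 0 ≤ ell D := by linarith
  have hT1 : 1 ≤ bigT D := by rw [bigT]; exact Real.one_le_exp (by positivity)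
  have hT0 : 0 < bigT D := by linarith
  have ht0 : 1 ≤ t0 D := by rw [t0]; exact one_le_pow₀ (by linarith)
  have hD1 : (1 : ℝ) ≤ D := by
    by_contra h
    have hD0 : D = 0 := by
      have : (D : ℝ) < 1 := not_le.mp h
      have : D < 1 := by exact_mod_cast this
      omega
    have : ell D = 0 := by rw [ell, hD0]; simp
    linarith
  have hP2 : 0 < Skeleton.P2 D := by
    rw [Skeleton.P2]
    exact div_pos (Real.rpow_pos_of_pos (by rw [bigP]; exact Real.exp_pos _) _) (pow_pos hT0 _)
  have hP2pp : 0 ≤ P2pp D := by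
    rw [P2pp]
    exact mul_nonneg (mul_nonneg (Real.rpow_nonneg (Real.exp_pos _).le _) (Nat.cast_nonneg _))
      (by linarith)
  -- `P″₂/x ≥ P″₂/P₂ = D t₀ T¹⁰ ≥ T`
  have h1 : P2pp D / Skeleton.P2 D ≤ P2pp D / x :=
    div_le_div_of_nonneg_left hP2pp hx0 hx.le
  refine le_trans ?_ h1
  rw [P2pp_div_P2_eq]
  calc bigT D = 1 * 1 * (bigT D * 1) := by ring
    _ ≤ (D : ℝ) * t0 D * (bigT D * bigT D ^ 9) := by
        gcongr
        exact one_le_pow₀ hT1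
    _ = (D : ℝ) * t0 D * bigT D ^ 10 := by ring

/-- On the top range: for `x ≥ 1`, `P″₂/x ≤ P″₂`. [cite: Zhang2022LandauSiegel, §12 proof of Lemma 12.3, p. 70] -/
theorem P2pp_div_le_of_one_le (D : ℕ) {x : ℝ} (hx : 1 ≤ x) : P2pp D / x ≤ P2pp D := by
  have ht0 : 0 ≤ t0 D := by rw [t0]; exact pow_nonneg (Real.log_natCast_nonneg D) _
  have hP2pp : 0 ≤ P2pp D := by
    rw [P2pp]
    exact mul_nonneg (mul_nonneg (Real.rpow_nonneg (Real.exp_pos _).le _) (Nat.cast_nonneg _)) ht0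
  exact div_le_self hP2pp hx

/-! ## The circle value `circ030` in closed form (u031 with the primitive evaluated) -/

/-- `β₆ − w ≠ 0` for `|w| = α`, `α > 0` (`|β₆| = 3α/2`). [cite: Zhang2022LandauSiegel, §12 proof of Lemma 12.3, p. 70] -/
theorem beta6_sub_ne_zero_of_norm_eq {D : ℕ} (hα : 0 < alpha D) {w : ℂ} (hw : ‖w‖ = alpha D) :
    beta6 D - w ≠ 0 := by
  intro h
  have hb : ‖beta6 D‖ = 3 * alpha D / 2 := by
    rw [beta6, show (3 : ℂ) * I * (alpha D : ℂ) / 2 = ((3 * alpha D / 2 : ℝ) : ℂ) * I by push_cast; ring,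
      norm_mul, Complex.norm_I, mul_one, Complex.norm_real, Real.norm_of_nonneg (by positivity)]
  have : beta6 D = w := sub_eq_zero.mp h
  rw [this, hw] at hb
  linarith

/-- **`circ030` in closed form**: for all large `D`, `j ∈ {1,2,3}`, `d, r ≥ 1`, `P″₁ < dr < P₂`, `|w| = α`,
`(2πi)⁻¹∮_{|s|=5α}(…)(P″₂/dr)^s ds/s = w − β₆ + β_{j+1} + β_{j+2} + β_{j+1}β_{j+2}·((P″₂/dr)^{β₆−w} − 1)/(β₆ − w)`
(`Typed.Sec12B.U031_holds` and `Typed.Sec12B.integral_cpow_sub_one`) — the main-term shape the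
Lemma-8.4 small-circle evaluation delivers (`Lemma84.circ_omega1_eval_forAllLarge`).
[cite: Zhang2022LandauSiegel, §12 proof of Lemma 12.3, p. 70, tex L3571] -/
theorem circ030_eq_closedForm (c' : ℝ) : ForAllLarge fun D _ _ =>
    ∀ j ∈ ({1, 2, 3} : Finset ℕ), ∀ d r : ℕ, 1 ≤ d → 1 ≤ r →
      P1pp D < ((d * r : ℕ) : ℝ) → ((d * r : ℕ) : ℝ) < Skeleton.P2 D → ∀ w : ℂ, ‖w‖ = alpha D →
        circ030 c' D j d r w =
          w - beta6 D + betaJ c' D (j + 1) + betaJ c' D (j + 2) +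
            betaJ c' D (j + 1) * betaJ c' D (j + 2) *
              ((((P2pp D / ((d * r : ℕ) : ℝ) : ℝ) : ℂ) ^ (beta6 D - w) - 1) / (beta6 D - w)) := by
  have h3 : ForAllLarge fun D _ _ => 3 ≤ ell D := by
    refine ForAllLarge.of_le ⌈Real.exp 3⌉₊ fun D _ χ hD _ _ => ?_
    have hexp : Real.exp 3 ≤ D := le_trans (Nat.le_ceil _) (by exact_mod_cast hD)
    exact (Real.le_log_iff_exp_le (lt_of_lt_of_le (Real.exp_pos _) hexp)).mpr hexp
  refine ((U031_holds c').and h3).mono ?_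
  intro D _ χ _ _ ⟨H31, hL3⟩ j hj d r hd hr hlo hhi w hw
  rw [H31 j hj d r hd hr hlo hhi w hw]
  have hℓ0 : 0 < ell D := by linarith
  have hα : 0 < alpha D := by rw [alpha, bigP, Real.log_exp]; positivity
  have hs : beta6 D - w ≠ 0 := beta6_sub_ne_zero_of_norm_eq hα hw
  have hdr1 : (1 : ℝ) ≤ ((d * r : ℕ) : ℝ) := by exact_mod_cast Nat.one_le_iff_ne_zero.mpr (by positivity)
  have hdr0 : (0 : ℝ) < ((d * r : ℕ) : ℝ) := by linarith
  have hY : 1 ≤ P2pp D / ((d * r : ℕ) : ℝ) := by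
    have hT1 : 1 ≤ bigT D := by rw [bigT]; exact Real.one_le_exp (by positivity)
    exact hT1.trans (bigT_le_P2pp_div hL3 hdr0 hhi)
  rw [integral_cpow_sub_one (lt_of_lt_of_le one_pos hY) hs]

/-! ## Perron-output bookkeeping: `LSeries.term` form vs the Q-34 summand form -/

/-- `Σ' term(f,s,n)·g(n) = Σ' f(n)n^{−s}·g(n)` for `s ≠ 0` (the `n = 0` terms agree: `0^{s} = 0`): the output
summand of `GaussWeight.integral_LSeries_mul_kernel` versus the summand of
`XiZeroMajorant.xi_sharp_sub_smooth_le`. [cite: Zhang2022LandauSiegel, §4 (4.2)–(4.3)] -/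
theorem tsum_term_mul_eq {f : ℕ → ℂ} {s : ℂ} (hs : s ≠ 0) (g : ℕ → ℂ) :
    ∑' n : ℕ, LSeries.term f s n * g n = ∑' n : ℕ, f n / (n : ℂ) ^ s * g n := by
  refine tsum_congr fun n => ?_
  rcases Nat.eq_zero_or_pos n with rfl | hn
  · simp [LSeries.term, Complex.zero_cpow hs]
  · rw [LSeries.term_of_ne_zero hn.ne']

/-- `1 − β₆ + w ≠ 0` for `|w| = α < 1/5` (real part `≥ 1 − α > 0`; `β₆` is purely imaginary).
[cite: Zhang2022LandauSiegel, §12 proof of Lemma 12.3, p. 70] -/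
theorem one_sub_beta6_add_ne_zero {D : ℕ} (hα : alpha D < 1) {w : ℂ} (hw : ‖w‖ = alpha D) :
    1 - beta6 D + w ≠ 0 := by
  intro h
  have hre : (1 - beta6 D + w).re = 0 := by rw [h]; simp
  have hb : (beta6 D).re = 0 := by simp [beta6]
  have hw' : |w.re| ≤ alpha D := hw ▸ Complex.abs_re_le_norm w
  simp only [Complex.sub_re, Complex.add_re, Complex.one_re, hb, sub_zero] at hre
  have := neg_le_of_abs_le hw'
  linarith

/-! ## The assembly -/

/-- **`Z22:§12.u030` (relative reading) from the contour evaluation of the `g`-smoothed sum.** If, for all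
large `D` under (A), every `j ∈ {1,2,3}`, `d, r ≥ 1` with `P″₁ < dr < P₂` and `|w| = α`, the `g_{𝓛³⁰}`-smoothed
sum `Σ_l χ(l)ξ_j(l;d,r)l^{−(1−β₆+w)}g(P″₂/(drl))` equals `L′(1,χ)Π(d,r)·circ030` up to `C𝓛⁻¹⁵Π̂(dr)²`
(hypothesis `hApp`: the shifted Lemma-8.4 contour at `Λ = 𝓛³⁰`, route (i) of record), then `U030Rel c′`:
the sharp sum `innerSumLow` differs from the smoothed one by `C·(r/φ(r))·𝓛⁻¹⁵`
(`XiZeroMajorant.xi_sharp_sub_smooth_le` at `Z = P″₂/(dr) ∈ [T, P″₂]`) and `r/φ(r) ≤ Π̂(dr)²`.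
[cite: Zhang2022LandauSiegel, §12 proof of Lemma 12.3, p. 70, tex L3552] -/
theorem u030Rel_of_smoothedEval (c' : ℝ)
    (hApp : ∃ C : ℝ, ForAllLarge fun D _ χ => AssumptionA D χ →
      ∀ j ∈ ({1, 2, 3} : Finset ℕ), ∀ d r : ℕ, 1 ≤ d → 1 ≤ r →
        P1pp D < ((d * r : ℕ) : ℝ) → ((d * r : ℕ) : ℝ) < Skeleton.P2 D → ∀ w : ℂ, ‖w‖ = alpha D →
          ‖(∑' l : ℕ, χ (l : ZMod D) * xiZero c' D j l d r / (l : ℂ) ^ (1 - beta6 D + w) *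
                (gW D (P2pp D / ((d * r : ℕ) : ℝ) / l) : ℂ)) -
              deriv χ.LFunction 1 * PiW χ d r * circ030 c' D j d r w‖ ≤
            C * (ell D ^ 15)⁻¹ * (∏ q ∈ (d * r).primeFactors, (1 - (q : ℝ)⁻¹)⁻¹) ^ 2) :
    U030Rel c' := by
  obtain ⟨C34, hC34, h34⟩ := XiZeroMajorant.xi_sharp_sub_smooth_le
  obtain ⟨D34, h34'⟩ := h34 c'
  obtain ⟨CA, hA⟩ := hApp
  have hE3 : ForAllLarge fun D _ χ => 3 ≤ ell D ∧ ∀ (j d r : ℕ), 1 ≤ d → 1 ≤ r → ∀ w : ℂ,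
      ‖w‖ ≤ alpha D → ∀ Z : ℝ, bigT D ≤ Z → Z ≤ P2pp D →
        ‖(∑ l ∈ Finset.Ico 1 ⌈Z⌉₊, χ (l : ZMod D) * xiZero c' D j l d r / (l : ℂ) ^ (1 - beta6 D + w)) -
            ∑' l : ℕ, χ (l : ZMod D) * xiZero c' D j l d r / (l : ℂ) ^ (1 - beta6 D + w) *
              (gW D (Z / l) : ℂ)‖ ≤ C34 * ((r : ℝ) / r.totient) * (ell D ^ 15)⁻¹ := by
    refine ForAllLarge.of_le (max D34 ⌈Real.exp 3⌉₊) fun D _ χ hD _ _ => ⟨?_, ?_⟩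
    · have hexp : Real.exp 3 ≤ D := le_trans (Nat.le_ceil _) (by exact_mod_cast le_trans (le_max_right _ _) hD)
      exact (Real.le_log_iff_exp_le (lt_of_lt_of_le (Real.exp_pos _) hexp)).mpr hexp
    · intro j d r hd hr w hw Z hZ1 hZ2
      exact (h34' D (le_trans (le_max_left _ _) hD) χ j d r hd hr w hw Z hZ1 hZ2).2
  refine ⟨C34 + CA, (hA.and hE3).mono ?_⟩
  intro D _ χ _ _ ⟨HA, hL3, H34⟩ hAss j hj d r hd hr hlo hhi w hw
  have hd0 : d ≠ 0 := by omega
  have hr0 : r ≠ 0 := by omega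
  have hdr1 : (1 : ℝ) ≤ ((d * r : ℕ) : ℝ) := by exact_mod_cast Nat.one_le_iff_ne_zero.mpr (by positivity)
  have hdr0 : (0 : ℝ) < ((d * r : ℕ) : ℝ) := by linarith
  set Z : ℝ := P2pp D / ((d * r : ℕ) : ℝ) with hZ
  have hZ1 : bigT D ≤ Z := bigT_le_P2pp_div hL3 hdr0 hhi
  have hZ2 : Z ≤ P2pp D := P2pp_div_le_of_one_le D hdr1
  -- the two bounds
  have h1 := H34 j d r hd hr w hw.le Z hZ1 hZ2
  have h2 := HA hAss j hj d r hd hr hlo hhi w hw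
  -- `innerSumLow` is the sharp sum at `Z = P″₂/(dr)`
  have hsharp : innerSumLow c' χ j d r w =
      ∑ l ∈ Finset.Ico 1 ⌈Z⌉₊, χ (l : ZMod D) * xiZero c' D j l d r / (l : ℂ) ^ (1 - beta6 D + w) := by
    rw [innerSumLow]
  -- the weight comparison `r/φ(r) ≤ Π̂(dr)²`
  set R : ℝ := (∏ q ∈ (d * r).primeFactors, (1 - (q : ℝ)⁻¹)⁻¹) ^ 2 with hR
  have hρR : (r : ℝ) / r.totient ≤ R :=
    le_trans (self_div_totient_le_prod hd0 hr0) (prod_le_prod_sq _)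
  have hL : 0 ≤ (ell D ^ 15)⁻¹ := inv_nonneg.mpr (pow_nonneg (by linarith) 15)
  have h1' : ‖innerSumLow c' χ j d r w -
      ∑' l : ℕ, χ (l : ZMod D) * xiZero c' D j l d r / (l : ℂ) ^ (1 - beta6 D + w) *
        (gW D (Z / l) : ℂ)‖ ≤ C34 * (ell D ^ 15)⁻¹ * R := by
    rw [hsharp]
    calc _ ≤ C34 * ((r : ℝ) / r.totient) * (ell D ^ 15)⁻¹ := h1
      _ = C34 * (ell D ^ 15)⁻¹ * ((r : ℝ) / r.totient) := by ring
      _ ≤ C34 * (ell D ^ 15)⁻¹ * R := mul_le_mul_of_nonneg_left hρR (mul_nonneg hC34 hL)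
  calc ‖innerSumLow c' χ j d r w - deriv χ.LFunction 1 * PiW χ d r * circ030 c' D j d r w‖
      = ‖(innerSumLow c' χ j d r w -
            ∑' l : ℕ, χ (l : ZMod D) * xiZero c' D j l d r / (l : ℂ) ^ (1 - beta6 D + w) *
              (gW D (Z / l) : ℂ)) +
          ((∑' l : ℕ, χ (l : ZMod D) * xiZero c' D j l d r / (l : ℂ) ^ (1 - beta6 D + w) *
              (gW D (Z / l) : ℂ)) -
            deriv χ.LFunction 1 * PiW χ d r * circ030 c' D j d r w)‖ := by ring_nf
    _ ≤ C34 * (ell D ^ 15)⁻¹ * R + CA * (ell D ^ 15)⁻¹ * R := (norm_add_le _ _).trans (add_le_add h1' h2)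
    _ = (C34 + CA) * (ell D ^ 15)⁻¹ * R := by ring

/-- **`Z22:§12.u030` (relative reading) from the contour evaluation in CLOSED FORM** — the same as
`u030Rel_of_smoothedEval` with the main term written as the Lemma-8.4 small-circle package delivers it,
`L′(1,χ)Π(d,r)·(w − β₆ + β_{j+1} + β_{j+2} + β_{j+1}β_{j+2}((P″₂/dr)^{β₆−w} − 1)/(β₆ − w))`
(`Lemma84.circ_omega1_eval_forAllLarge`), matched to `circ030` by `circ030_eq_closedForm` (u031).
[cite: Zhang2022LandauSiegel, §12 proof of Lemma 12.3, p. 70, tex L3552–L3571] -/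
theorem u030Rel_of_smoothedEvalClosed (c' : ℝ)
    (hAppC : ∃ C : ℝ, ForAllLarge fun D _ χ => AssumptionA D χ →
      ∀ j ∈ ({1, 2, 3} : Finset ℕ), ∀ d r : ℕ, 1 ≤ d → 1 ≤ r →
        P1pp D < ((d * r : ℕ) : ℝ) → ((d * r : ℕ) : ℝ) < Skeleton.P2 D → ∀ w : ℂ, ‖w‖ = alpha D →
          ‖(∑' l : ℕ, χ (l : ZMod D) * xiZero c' D j l d r / (l : ℂ) ^ (1 - beta6 D + w) *
                (gW D (P2pp D / ((d * r : ℕ) : ℝ) / l) : ℂ)) -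
              deriv χ.LFunction 1 * PiW χ d r *
                (w - beta6 D + betaJ c' D (j + 1) + betaJ c' D (j + 2) +
                  betaJ c' D (j + 1) * betaJ c' D (j + 2) *
                    ((((P2pp D / ((d * r : ℕ) : ℝ) : ℝ) : ℂ) ^ (beta6 D - w) - 1) / (beta6 D - w)))‖ ≤
            C * (ell D ^ 15)⁻¹ * (∏ q ∈ (d * r).primeFactors, (1 - (q : ℝ)⁻¹)⁻¹) ^ 2) :
    U030Rel c' := by
  obtain ⟨C, hC⟩ := hAppC
  refine u030Rel_of_smoothedEval c' ⟨C, (hC.and (circ030_eq_closedForm c')).mono ?_⟩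
  intro D _ χ _ _ ⟨H, H31⟩ hA j hj d r hd hr hlo hhi w hw
  rw [H31 j hj d r hd hr hlo hhi w hw]
  exact H hA j hj d r hd hr hlo hhi w hw

end Literature.NumberTheory.LFunctions.Zhang2022.Typed.Sec12B

end
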